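import Mathlib.Tactic
import HarnessLib
import Summits.CriticalPhenomena.PercolationContinuityZ3.Theorems.PercNearOneGluingNoHeavyLowerTailKnQuestion8UnifThreeCores

/-!
# Kozma–Nitzan's Question 8 at three relays — the normalised core (♦₁) of the universal k = 3 step (gen 32)

Support file (`--supports stmt-CriticalPhenomena-4575`, closed crux; independent mathematics on Kozma–Nitzan's Question 8,
arXiv:2401.12397 §5.5 p. 36), prover `prim-ineq-gen-6` (gen 32).  No definitions, no named facts, no sorries; standard axioms.
Memo `run/shared/lean/prim/prim-ineq-gen-6/PROOF-RCG3-G32.md` §3(c)–§4.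

After the reductions of the memo (§1–§3) the k = 3 merge step (RC-G3) of the uniform form becomes the six-variable inequality (♦₁)
`ν̂·λ′₂·(v̂+m̂) + λ(1−C)cσv̂ ≤ c·v̂·P·(K₁ + Cν̂)` with `ν̂ = (1−c)(1−σû) + cσv̂`, `P = 1 − (1−c)σû`, `û = 1 − v̂ − m̂`, `K₁ = ¾ − λ(1−λ)`,
`λ′₂ = (1+λ)Cc − 1 ≥ 0` and the single structural constraint `λ′₂·m̂ ≤ v̂` (the crossing vertex's C-defect, FINDING-G31 §5b).  For fixed
`û` the slack is a convex quadratic in `v̂` on `v̂ ≥ v̂₀ := λ′₂(1−û)/(1+λ′₂)`; its value (`k3_avalue`) and slope (`k3_bvalue`) at `v̂₀` are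
nonnegative by the polynomial cores of `…UnifThreeCores`, and `k3_diamond1` assembles the exact Taylor identity.
[cite: KozmaNitzan2024, Question 8 (§5.5 p. 36)]
-/

namespace Summit.CriticalPhenomena.PercolationContinuityZ3.Theorems

namespace PocketCert

/-- **(a″)**: for `C ∈ [1/((1+λ)(1−d)), 1]` the value condition follows from CORE ψ, because its left side is non-increasing in `C`
(slope `(1+λ)·y·(d(1−y) − λ) ≤ 0`):  `(1−y)((1+λ)C−1)(λ+dy) + λ(1+λ)(1−C) ≤ (1+λ)(1−dy)(¾ − λ(1−λ))`.
[cite: KozmaNitzan2024, Question 8 (§5.5 p. 36)] -/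
theorem k3_aprime (lam d y C : ℝ) (hl0 : 0 < lam) (hl1 : lam < 1) (hd0 : 0 ≤ d) (hy0 : 0 ≤ y) (hy1 : y ≤ 1)
    (hCpos : 0 ≤ C) (hC1 : C ≤ 1) (hC0 : 1 ≤ (1 + lam) * C * (1 - d)) :
    (1 - y) * ((1 + lam) * C - 1) * (lam + d * y) + lam * (1 + lam) * (1 - C)
      ≤ (1 + lam) * (1 - d * y) * (3 / 4 - lam * (1 - lam)) := by
  have h1d : 0 < 1 - d := by
    by_contra h
    push Not at h
    have : C * (1 - d) ≤ 0 := mul_nonpos_of_nonneg_of_nonpos hCpos h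
    nlinarith
  have hd' : 1 ≤ (1 + lam) * (1 - d) := by
    nlinarith [mul_nonneg (sub_nonneg.mpr hC1) h1d.le]
  have hd1 : d * (1 + lam) ≤ lam := by nlinarith
  have hψ := k3_psi_core lam d y hl0 hl1 hd0 hd1 hy0 hy1
  have key : (1 - d) * ((1 - y) * ((1 + lam) * C - 1) * (lam + d * y) + lam * (1 + lam) * (1 - C))
      = ((1 - y) * d * (lam + d * y) + lam * ((1 + lam) * (1 - d) - 1))
        + ((1 + lam) * (1 - d) * C - 1) * y * (d * (1 - y) - lam) := by ring
  have hneg : ((1 + lam) * (1 - d) * C - 1) * y * (d * (1 - y) - lam) ≤ 0 := by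
    have a1 : 0 ≤ ((1 + lam) * (1 - d) * C - 1) * y := mul_nonneg (by nlinarith) hy0
    have a2 : d * (1 - y) - lam ≤ 0 := by nlinarith [mul_nonneg hd0 hy0]
    exact mul_nonpos_of_nonneg_of_nonpos a1 a2
  have h3 : (1 - d) * ((1 - y) * ((1 + lam) * C - 1) * (lam + d * y) + lam * (1 + lam) * (1 - C))
      ≤ (1 - d) * ((1 + lam) * (1 - d * y) * (3 / 4 - lam * (1 - lam))) := by
    rw [key]; nlinarith
  exact le_of_mul_le_mul_left h3 h1d

/-- **(a-value)**: the value of the slack of (♦₁) at the marginal point, times `(1+λ)/(c·v̂₀)`, is nonnegative: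
`[(1+λ)C(1−c)(1−σû) + σ(1−û)λ′₂](λ + (1−c)σû) + λ(1+λ)(1−C)σ ≤ (1+λ)(1 − (1−c)σû)(¾ − λ(1−λ))`
(monotone in `σ` at fixed `y = σû`; then `k3_aprime` with `d = 1−c`).
[cite: KozmaNitzan2024, Question 8 (§5.5 p. 36)] -/
theorem k3_avalue (lam c C sig uh : ℝ) (hl0 : 0 < lam) (hl1 : lam < 1) (hc0 : 0 < c) (hc1 : c ≤ 1) (hC1 : C ≤ 1)
    (hW : 1 ≤ (1 + lam) * C * c) (hs0 : 0 ≤ sig) (hs1 : sig ≤ 1) (hu0 : 0 ≤ uh) (hu1 : uh ≤ 1) :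
    ((1 + lam) * C * (1 - c) * (1 - sig * uh) + sig * (1 - uh) * ((1 + lam) * C * c - 1)) * (lam + (1 - c) * (sig * uh))
        + lam * (1 + lam) * (1 - C) * sig
      ≤ (1 + lam) * (1 - (1 - c) * (sig * uh)) * (3 / 4 - lam * (1 - lam)) := by
  have hy0 : 0 ≤ sig * uh := mul_nonneg hs0 hu0
  have hy1 : sig * uh ≤ 1 := by nlinarith
  have hd0 : 0 ≤ 1 - c := by linarith
  have hCpos : 0 ≤ C := by
    by_contra h
    push Not at h
    have hp : 0 < (1 + lam) * c := by positivity
    nlinarith [mul_neg_of_neg_of_pos h hp]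
  have hC0' : 1 ≤ (1 + lam) * C * (1 - (1 - c)) := by
    have : (1 + lam) * C * (1 - (1 - c)) = (1 + lam) * C * c := by ring
    linarith
  have ha := k3_aprime lam (1 - c) (sig * uh) C hl0 hl1 hd0 hy0 hy1 hCpos hC1 hC0'
  -- monotonicity in σ: σ(1−û) ≤ 1 − σû and σ ≤ 1
  have t1 : (1 + lam) * C * (1 - c) * (1 - sig * uh) + sig * (1 - uh) * ((1 + lam) * C * c - 1)
      ≤ (1 - sig * uh) * ((1 + lam) * C - 1) := by
    have e : (1 - sig * uh) * ((1 + lam) * C - 1)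
        = (1 + lam) * C * (1 - c) * (1 - sig * uh) + (1 - sig * uh) * ((1 + lam) * C * c - 1) := by ring
    rw [e]
    have : sig * (1 - uh) ≤ 1 - sig * uh := by nlinarith
    nlinarith [mul_le_mul_of_nonneg_right this (by linarith : (0:ℝ) ≤ (1 + lam) * C * c - 1)]
  have t2 : 0 ≤ lam + (1 - c) * (sig * uh) := by positivity
  have t3 := mul_le_mul_of_nonneg_right t1 t2
  have t4 : lam * (1 + lam) * (1 - C) * sig ≤ lam * (1 + lam) * (1 - C) := by
    have : 0 ≤ lam * (1 + lam) * (1 - C) := by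
      have : 0 ≤ 1 - C := by linarith
      positivity
    nlinarith
  linarith

set_option maxHeartbeats 400000 in
/-- **(b-value)**: the slope of the slack of (♦₁) at the marginal point, times `(1+λ)/c`, is nonnegative:
`σ(1−û)λ′₂((1+λ) − 2P) + λ(1+λ)(1−C)σ ≤ (1+λ)·P·(¾ − λ(1−λ))` with `P = 1 − (1−c)σû`
(cores b1 at `C = 1` and b2 at `(1+λ)Cc = 1`, linear interpolation in `C`).
[cite: KozmaNitzan2024, Question 8 (§5.5 p. 36)] -/
theorem k3_bvalue (lam c C sig uh : ℝ) (hl0 : 0 < lam) (hl1 : lam < 1) (hc0 : 0 < c) (hc1 : c ≤ 1) (hC1 : C ≤ 1)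
    (hW : 1 ≤ (1 + lam) * C * c) (hs0 : 0 ≤ sig) (hs1 : sig ≤ 1) (hu0 : 0 ≤ uh) (hu1 : uh ≤ 1) :
    sig * (1 - uh) * ((1 + lam) * C * c - 1) * ((1 + lam) - 2 * (1 - (1 - c) * (sig * uh)))
        + lam * (1 + lam) * (1 - C) * sig
      ≤ (1 + lam) * (1 - (1 - c) * (sig * uh)) * (3 / 4 - lam * (1 - lam)) := by
  set P := 1 - (1 - c) * (sig * uh) with hP
  set K := 3 / 4 - lam * (1 - lam) with hK
  have hK0 : 1 / 2 ≤ K := by rw [hK]; nlinarith [sq_nonneg (lam - 1 / 2)]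
  have hy0 : 0 ≤ sig * uh := mul_nonneg hs0 hu0
  have hy1 : sig * uh ≤ 1 := by nlinarith
  have hPc : c ≤ P := by rw [hP]; nlinarith [mul_nonneg (by linarith : (0:ℝ) ≤ 1 - c) (by linarith : (0:ℝ) ≤ 1 - sig * uh)]
  have hP1 : P ≤ 1 := by rw [hP]; nlinarith [mul_nonneg (by linarith : (0:ℝ) ≤ 1 - c) hy0]
  have hCpos : 0 < C := by
    by_contra h
    push Not at h
    have hp : 0 < (1 + lam) * c := by positivity
    nlinarith [mul_nonpos_of_nonpos_of_nonneg h hp.le]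
  have hcl : 1 ≤ (1 + lam) * c := by nlinarith [mul_le_mul_of_nonneg_right hC1 (by positivity : (0:ℝ) ≤ (1 + lam) * c)]
  have hb2 := k3_b2_core lam c hl0 hl1 hcl hc1
  -- λ(1+λ)(1−C) ≤ (1+λ)·c·K ≤ (1+λ)·P·K  (from b2 and (1+λ)Cc ≥ 1)
  have hlow : lam * (1 + lam) * (1 - C) ≤ (1 + lam) * P * K := by
    have e1 : lam * (1 + lam) * (1 - C) * c ≤ lam * ((1 + lam) * c - 1) := by nlinarith
    have e2 : lam * ((1 + lam) * c - 1) ≤ (1 + lam) * c ^ 2 * K := by rw [hK]; exact hb2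
    have e3 : (1 + lam) * c ^ 2 * K ≤ (1 + lam) * c * P * K := by
      have hcP2 : c ^ 2 ≤ c * P := by nlinarith
      have hk : 0 ≤ (1 + lam) * K := by positivity
      have := mul_le_mul_of_nonneg_left hcP2 hk
      have r1 : (1 + lam) * K * c ^ 2 = (1 + lam) * c ^ 2 * K := by ring
      have r2 : (1 + lam) * K * (c * P) = (1 + lam) * c * P * K := by ring
      linarith [r1, r2]
    have e4 : lam * (1 + lam) * (1 - C) * c ≤ ((1 + lam) * P * K) * c := by nlinarith
    exact le_of_mul_le_mul_right e4 hc0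
  have hsigC : lam * (1 + lam) * (1 - C) * sig ≤ lam * (1 + lam) * (1 - C) := by
    have : 0 ≤ lam * (1 + lam) * (1 - C) := by
      have : 0 ≤ 1 - C := by linarith
      positivity
    nlinarith
  rcases le_or_gt ((1 + lam) - 2 * P) 0 with hneg | hpos
  · -- first term ≤ 0
    have t1 : sig * (1 - uh) * ((1 + lam) * C * c - 1) * ((1 + lam) - 2 * P) ≤ 0 := by
      apply mul_nonpos_of_nonneg_of_nonpos _ hneg
      have : 0 ≤ 1 - uh := by linarith
      have : 0 ≤ (1 + lam) * C * c - 1 := by linarith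
      positivity
    linarith
  · -- interpolate between C = 1 (core b1) and (1+λ)Cc = 1 (core b2)
    have t1 : sig * (1 - uh) * ((1 + lam) * C * c - 1) * ((1 + lam) - 2 * P)
        ≤ ((1 + lam) * C * c - 1) * ((1 + lam) - 2 * P) := by
      have hsu : sig * (1 - uh) ≤ 1 := by nlinarith
      have hx : 0 ≤ ((1 + lam) * C * c - 1) * ((1 + lam) - 2 * P) := mul_nonneg (by linarith) hpos.le
      nlinarith
    have hb1 := k3_b1_core lam c P hl0 hl1 hcl hPc hP1
    -- H1 := (1+λ)PK − ((1+λ)c−1)(L−2P) ≥ 0 ; Hlo := (1+λ)cPK − λ((1+λ)c−1) ≥ 0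
    have H1 : 0 ≤ (1 + lam) * P * K - ((1 + lam) * c - 1) * ((1 + lam) - 2 * P) := by rw [hK]; linarith
    have Hlo : 0 ≤ (1 + lam) * c * P * K - lam * ((1 + lam) * c - 1) := by
      have hcP2 : c ^ 2 ≤ c * P := by nlinarith
      have hk : 0 ≤ (1 + lam) * K := by positivity
      have e1 : (1 + lam) * c ^ 2 * K ≤ (1 + lam) * c * P * K := by
        have := mul_le_mul_of_nonneg_left hcP2 hk
        have r1 : (1 + lam) * K * c ^ 2 = (1 + lam) * c ^ 2 * K := by ring
        have r2 : (1 + lam) * K * (c * P) = (1 + lam) * c * P * K := by ring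
        linarith [r1, r2]
      have e2 : lam * ((1 + lam) * c - 1) ≤ (1 + lam) * c ^ 2 * K := by rw [hK]; exact hb2
      linarith
    have key : ((1 + lam) * c - 1) * ((1 + lam) * P * K - (((1 + lam) * C * c - 1) * ((1 + lam) - 2 * P) + lam * (1 + lam) * (1 - C)))
        = ((1 + lam) * c * C - 1) * ((1 + lam) * P * K - ((1 + lam) * c - 1) * ((1 + lam) - 2 * P))
          + (1 + lam) * (1 - C) * ((1 + lam) * c * P * K - lam * ((1 + lam) * c - 1)) := by ring
    have hCc : 0 ≤ (1 + lam) * c * C - 1 := by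
      have : (1 + lam) * c * C = (1 + lam) * C * c := by ring
      linarith
    have hpos2 : 0 ≤ ((1 + lam) * c - 1) * ((1 + lam) * P * K - (((1 + lam) * C * c - 1) * ((1 + lam) - 2 * P) + lam * (1 + lam) * (1 - C))) := by
      rw [key]
      have a1 := mul_nonneg hCc H1
      have h1C : 0 ≤ (1 + lam) * (1 - C) := mul_nonneg (by linarith) (sub_nonneg.mpr hC1)
      have a2 : 0 ≤ (1 + lam) * (1 - C) * ((1 + lam) * c * P * K - lam * ((1 + lam) * c - 1)) :=
        mul_nonneg h1C Hlo
      linarith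
    rcases eq_or_lt_of_le hcl with heq | hlt
    · -- (1+λ)c = 1 forces C = 1
      have hC : C = 1 := by
        have e : (1 + lam) * C * c = C * ((1 + lam) * c) := by ring
        rw [← heq, mul_one] at e
        linarith
      subst hC
      linarith
    · have hposc : 0 < (1 + lam) * c - 1 := by linarith
      have := (mul_nonneg_iff_of_pos_left hposc).mp hpos2
      linarith

set_option maxHeartbeats 400000 in
/-- **(♦₁)** — the normalised core of the universal k = 3 merge step.  With `û = 1 − v̂ − m̂`, `ν̂ = (1−c)(1−σû) + cσv̂`,
`P = 1 − (1−c)σû`, `λ′₂ = (1+λ)Cc − 1 ≥ 0` and the crossing constraint `λ′₂·m̂ ≤ v̂`: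
`ν̂·λ′₂·(v̂+m̂) + λ(1−C)cσv̂ ≤ c·v̂·P·(¾ − λ(1−λ) + C·ν̂)`.  Proof: exact Taylor expansion of the (convex, quadratic in `v̂`) slack
around `v̂₀ = λ′₂(1−û)/(1+λ′₂)` with `k3_avalue` (value) and `k3_bvalue` (slope).
[cite: KozmaNitzan2024, Question 8 (§5.5 p. 36)] -/
theorem k3_diamond1 (lam c C sig vh mh : ℝ) (hl0 : 0 < lam) (hl1 : lam < 1) (hc0 : 0 < c) (hc1 : c ≤ 1) (hC1 : C ≤ 1)
    (hW : 1 ≤ (1 + lam) * C * c) (hs0 : 0 ≤ sig) (hs1 : sig ≤ 1) (hv0 : 0 ≤ vh) (hm0 : 0 ≤ mh) (hvm : vh + mh ≤ 1)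
    (hcross : ((1 + lam) * C * c - 1) * mh ≤ vh) :
    ((1 - c) * (1 - sig * (1 - vh - mh)) + c * sig * vh) * ((1 + lam) * C * c - 1) * (vh + mh)
        + lam * (1 - C) * c * sig * vh
      ≤ c * vh * (1 - (1 - c) * (sig * (1 - vh - mh)))
          * (3 / 4 - lam * (1 - lam) + C * ((1 - c) * (1 - sig * (1 - vh - mh)) + c * sig * vh)) := by
  have hu0 : 0 ≤ (1 - vh - mh) := by linarith
  have hu1 : (1 - vh - mh) ≤ 1 := by linarith
  have hWpos : 0 < ((1 + lam) * C * c) := by linarith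
  have hCpos : 0 < C := by
    by_contra h
    push Not at h
    have hp : 0 < (1 + lam) * c := by positivity
    have e : (1 + lam) * C * c = C * ((1 + lam) * c) := by ring
    nlinarith [mul_nonpos_of_nonpos_of_nonneg h hp.le]
  have hy0 : 0 ≤ sig * (1 - vh - mh) := mul_nonneg hs0 hu0
  have hy1 : sig * (1 - vh - mh) ≤ 1 := by nlinarith
  have hPpos : 0 ≤ (1 - (1 - c) * (sig * (1 - vh - mh))) := by nlinarith [mul_nonneg (sub_nonneg.mpr hc1) (sub_nonneg.mpr hy1)]
  have hSA0 : 0 ≤ ((1 + lam) * (1 - (1 - c) * (sig * (1 - vh - mh))) * (3 / 4 - lam * (1 - lam)) - ((((1 + lam) * C * (1 - c) * (1 - sig * (1 - vh - mh)) + sig * (1 - (1 - vh - mh)) * ((1 + lam) * C * c - 1)) * (lam + (1 - c) * (sig * (1 - vh - mh))) + lam * (1 + lam) * (1 - C) * sig))) := by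
    have := k3_avalue lam c C sig (1 - vh - mh) hl0 hl1 hc0 hc1 hC1 hW hs0 hs1 hu0 hu1
    linarith
  have hSB0 : 0 ≤ ((1 + lam) * (1 - (1 - c) * (sig * (1 - vh - mh))) * (3 / 4 - lam * (1 - lam)) - (sig * (1 - (1 - vh - mh)) * ((1 + lam) * C * c - 1) * ((1 + lam) - 2 * (1 - (1 - c) * (sig * (1 - vh - mh)))) + lam * (1 + lam) * (1 - C) * sig)) := by
    have := k3_bvalue lam c C sig (1 - vh - mh) hl0 hl1 hc0 hc1 hC1 hW hs0 hs1 hu0 hu1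
    linarith
  -- v̂ ≥ v̂₀, i.e. W·v̂ − V0 ≥ 0 where V0 = λ′₂(v̂ + m̂)
  have hD : 0 ≤ (((1 + lam) * C * c) * vh - ((((1 + lam) * C * c) - 1) * (vh + mh))) := by nlinarith
  -- exact Taylor identity (times (1+λ)·W²)
  have key : (1 + lam) * ((1 + lam) * C * c) ^ 2 * (c * vh * (1 - (1 - c) * (sig * (1 - vh - mh))) * ((3 / 4 - lam * (1 - lam)) + C * ((1 - c) * (1 - sig * (1 - vh - mh)) + c * sig * vh)) - (((1 - c) * (1 - sig * (1 - vh - mh)) + c * sig * vh) * ((1 + lam) * C * c - 1) * (vh + mh) + lam * (1 - C) * c * sig * vh))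
      = ((1 + lam) * C * c) * c * ((((1 + lam) * C * c) - 1) * (vh + mh)) * ((1 + lam) * (1 - (1 - c) * (sig * (1 - vh - mh))) * (3 / 4 - lam * (1 - lam)) - ((((1 + lam) * C * (1 - c) * (1 - sig * (1 - vh - mh)) + sig * (1 - (1 - vh - mh)) * ((1 + lam) * C * c - 1)) * (lam + (1 - c) * (sig * (1 - vh - mh))) + lam * (1 + lam) * (1 - C) * sig)))
        + (1 + lam) * c * (C * c * ((1 + lam) * (1 - (1 - c) * (sig * (1 - vh - mh))) * (3 / 4 - lam * (1 - lam)) - (sig * (1 - (1 - vh - mh)) * ((1 + lam) * C * c - 1) * ((1 + lam) - 2 * (1 - (1 - c) * (sig * (1 - vh - mh)))) + lam * (1 + lam) * (1 - C) * sig)) + ((1 + lam) * C * c) * (1 - (1 - c) * (sig * (1 - vh - mh))) * C * (1 - c) * (1 - sig * (1 - vh - mh))) * (((1 + lam) * C * c) * vh - ((((1 + lam) * C * c) - 1) * (vh + mh)))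
        + (1 + lam) * c * c * (1 - (1 - c) * (sig * (1 - vh - mh))) * C * sig * (((1 + lam) * C * c) * vh - ((((1 + lam) * C * c) - 1) * (vh + mh))) ^ 2 := by
    ring
  have hl2 : 0 ≤ (1 + lam) * C * c - 1 := by linarith
  have hV0 : 0 ≤ ((((1 + lam) * C * c) - 1) * (vh + mh)) := mul_nonneg hl2 (by linarith)
  have t1 : 0 ≤ ((1 + lam) * C * c) * c * ((((1 + lam) * C * c) - 1) * (vh + mh)) * ((1 + lam) * (1 - (1 - c) * (sig * (1 - vh - mh))) * (3 / 4 - lam * (1 - lam)) - ((((1 + lam) * C * (1 - c) * (1 - sig * (1 - vh - mh)) + sig * (1 - (1 - vh - mh)) * ((1 + lam) * C * c - 1)) * (lam + (1 - c) * (sig * (1 - vh - mh))) + lam * (1 + lam) * (1 - C) * sig))) :=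
    mul_nonneg (mul_nonneg (mul_nonneg hWpos.le hc0.le) hV0) hSA0
  have b1 : 0 ≤ C * c * ((1 + lam) * (1 - (1 - c) * (sig * (1 - vh - mh))) * (3 / 4 - lam * (1 - lam)) - (sig * (1 - (1 - vh - mh)) * ((1 + lam) * C * c - 1) * ((1 + lam) - 2 * (1 - (1 - c) * (sig * (1 - vh - mh)))) + lam * (1 + lam) * (1 - C) * sig)) := mul_nonneg (mul_nonneg hCpos.le hc0.le) hSB0
  have b2 : 0 ≤ ((1 + lam) * C * c) * (1 - (1 - c) * (sig * (1 - vh - mh))) * C * (1 - c) * (1 - sig * (1 - vh - mh)) :=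
    mul_nonneg (mul_nonneg (mul_nonneg (mul_nonneg hWpos.le hPpos) hCpos.le) (sub_nonneg.mpr hc1)) (sub_nonneg.mpr hy1)
  have t2 : 0 ≤ (1 + lam) * c * (C * c * ((1 + lam) * (1 - (1 - c) * (sig * (1 - vh - mh))) * (3 / 4 - lam * (1 - lam)) - (sig * (1 - (1 - vh - mh)) * ((1 + lam) * C * c - 1) * ((1 + lam) - 2 * (1 - (1 - c) * (sig * (1 - vh - mh)))) + lam * (1 + lam) * (1 - C) * sig)) + ((1 + lam) * C * c) * (1 - (1 - c) * (sig * (1 - vh - mh))) * C * (1 - c) * (1 - sig * (1 - vh - mh))) * (((1 + lam) * C * c) * vh - ((((1 + lam) * C * c) - 1) * (vh + mh))) :=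
    mul_nonneg (mul_nonneg (mul_nonneg (by linarith) hc0.le) (by linarith)) hD
  have t3 : 0 ≤ (1 + lam) * c * c * (1 - (1 - c) * (sig * (1 - vh - mh))) * C * sig * (((1 + lam) * C * c) * vh - ((((1 + lam) * C * c) - 1) * (vh + mh))) ^ 2 :=
    mul_nonneg (mul_nonneg (mul_nonneg (mul_nonneg (mul_nonneg (mul_nonneg (by linarith) hc0.le) hc0.le) hPpos) hCpos.le) hs0) (sq_nonneg _)
  have hsum : 0 ≤ (1 + lam) * ((1 + lam) * C * c) ^ 2 * (c * vh * (1 - (1 - c) * (sig * (1 - vh - mh))) * ((3 / 4 - lam * (1 - lam)) + C * ((1 - c) * (1 - sig * (1 - vh - mh)) + c * sig * vh)) - (((1 - c) * (1 - sig * (1 - vh - mh)) + c * sig * vh) * ((1 + lam) * C * c - 1) * (vh + mh) + lam * (1 - C) * c * sig * vh)) := by rw [key]; linarith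
  have hscale : 0 < (1 + lam) * ((1 + lam) * C * c) ^ 2 := mul_pos (by linarith) (pow_pos hWpos 2)
  have hfin := (mul_nonneg_iff_of_pos_left hscale).mp hsum
  linarith

/-- **(♦) ⟸ (♦₁): elimination of the merged vertex's A-mark `a`.**  With `ν̂`, `λ′₂`, the crossing constraint as in
`k3_diamond1`, `p̂ = c(1−σv̂) + aν̂` and `K = ¾ − λ(1−λ)a`:  `a²·Q ≤ c·v̂·p̂·(K + C·a·ν̂)` for every `a ∈ [0,1]`, where
`Q = ν̂λ′₂(v̂+m̂) + λ(1−C)cσv̂`.  Proof: the slack is `α₀ + α₁a + α₂a²` with `α₀ ≥ 0`; if `α₂ ≤ 0` it is concave in `a` and its values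
at `a = 0` (`α₀`) and `a = 1` (`k3_diamond1`) are `≥ 0`; if `α₂ > 0` then `Cν̂ > λ(1−λ)` and `α₁ ≥ 0` as well.
[cite: KozmaNitzan2024, Question 8 (§5.5 p. 36)] -/
theorem k3_diamond (lam a c C sig vh mh : ℝ) (hl0 : 0 < lam) (hl1 : lam < 1) (ha0 : 0 ≤ a) (ha1 : a ≤ 1)
    (hc0 : 0 < c) (hc1 : c ≤ 1) (hC1 : C ≤ 1)
    (hW : 1 ≤ (1 + lam) * C * c) (hs0 : 0 ≤ sig) (hs1 : sig ≤ 1) (hv0 : 0 ≤ vh) (hm0 : 0 ≤ mh) (hvm : vh + mh ≤ 1)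
    (hcross : ((1 + lam) * C * c - 1) * mh ≤ vh) :
    a ^ 2 * (((1 - c) * (1 - sig * (1 - vh - mh)) + c * sig * vh) * ((1 + lam) * C * c - 1) * (vh + mh) + lam * (1 - C) * c * sig * vh)
      ≤ (c * vh * (c * (1 - sig * vh) + a * ((1 - c) * (1 - sig * (1 - vh - mh)) + c * sig * vh)) * (3 / 4 - lam * (1 - lam) * a + C * a * ((1 - c) * (1 - sig * (1 - vh - mh)) + c * sig * vh))) := by
  have hd1 := k3_diamond1 lam c C sig vh mh hl0 hl1 hc0 hc1 hC1 hW hs0 hs1 hv0 hm0 hvm hcross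
  have hCpos : 0 < C := by
    by_contra h
    push Not at h
    have hp : 0 < (1 + lam) * c := mul_pos (by linarith) hc0
    have e : (1 + lam) * C * c = C * ((1 + lam) * c) := by ring
    nlinarith [mul_nonpos_of_nonpos_of_nonneg h hp.le]
  have hu0 : 0 ≤ 1 - vh - mh := by linarith
  have hsu : 0 ≤ 1 - sig * (1 - vh - mh) := by nlinarith [mul_nonneg hs0 hu0]
  have hN0 : 0 ≤ ((1 - c) * (1 - sig * (1 - vh - mh)) + c * sig * vh) := by
    have : 0 ≤ (1 - c) * (1 - sig * (1 - vh - mh)) := mul_nonneg (sub_nonneg.mpr hc1) hsu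
    have : 0 ≤ c * sig * vh := mul_nonneg (mul_nonneg hc0.le hs0) hv0
    linarith
  have hsv : 0 ≤ 1 - sig * vh := by nlinarith [mul_nonneg hs0 hv0]
  have hQ0 : 0 ≤ (((1 - c) * (1 - sig * (1 - vh - mh)) + c * sig * vh) * ((1 + lam) * C * c - 1) * (vh + mh) + lam * (1 - C) * c * sig * vh) := by
    have : 0 ≤ ((1 - c) * (1 - sig * (1 - vh - mh)) + c * sig * vh) * ((1 + lam) * C * c - 1) * (vh + mh) := mul_nonneg (mul_nonneg hN0 (by linarith)) (by linarith)
    have : 0 ≤ lam * (1 - C) * c * sig * vh :=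
      mul_nonneg (mul_nonneg (mul_nonneg (mul_nonneg hl0.le (sub_nonneg.mpr hC1)) hc0.le) hs0) hv0
    linarith
  -- the slack as a quadratic in a
  have hF1 : 0 ≤ (c * vh * (1 - (1 - c) * (sig * (1 - vh - mh))) * (3 / 4 - lam * (1 - lam) + C * ((1 - c) * (1 - sig * (1 - vh - mh)) + c * sig * vh)) - (((1 - c) * (1 - sig * (1 - vh - mh)) + c * sig * vh) * ((1 + lam) * C * c - 1) * (vh + mh) + lam * (1 - C) * c * sig * vh)) := by
    have e : c * vh * (1 - (1 - c) * (sig * (1 - vh - mh)))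
        = c * vh * (c * (1 - sig * vh) + 1 * ((1 - c) * (1 - sig * (1 - vh - mh)) + c * sig * vh)) := by ring
    linarith
  have hA0 : 0 ≤ (c * vh * (c * (1 - sig * vh)) * (3 / 4)) := by
    have h1 : 0 ≤ c * vh * (c * (1 - sig * vh)) := mul_nonneg (mul_nonneg hc0.le hv0) (mul_nonneg hc0.le hsv)
    exact mul_nonneg h1 (by norm_num)
  have key : (c * vh * (c * (1 - sig * vh) + a * ((1 - c) * (1 - sig * (1 - vh - mh)) + c * sig * vh)) * (3 / 4 - lam * (1 - lam) * a + C * a * ((1 - c) * (1 - sig * (1 - vh - mh)) + c * sig * vh))) - a ^ 2 * (((1 - c) * (1 - sig * (1 - vh - mh)) + c * sig * vh) * ((1 + lam) * C * c - 1) * (vh + mh) + lam * (1 - C) * c * sig * vh)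
      = (c * vh * (c * (1 - sig * vh)) * (3 / 4)) + (c * vh * (c * (1 - sig * vh) * (C * ((1 - c) * (1 - sig * (1 - vh - mh)) + c * sig * vh) - (lam * (1 - lam))) + 3 / 4 * ((1 - c) * (1 - sig * (1 - vh - mh)) + c * sig * vh))) * a + (c * vh * ((1 - c) * (1 - sig * (1 - vh - mh)) + c * sig * vh) * (C * ((1 - c) * (1 - sig * (1 - vh - mh)) + c * sig * vh) - (lam * (1 - lam))) - (((1 - c) * (1 - sig * (1 - vh - mh)) + c * sig * vh) * ((1 + lam) * C * c - 1) * (vh + mh) + lam * (1 - C) * c * sig * vh)) * a ^ 2 := by ring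
  have keyF1 : (c * vh * (1 - (1 - c) * (sig * (1 - vh - mh))) * (3 / 4 - lam * (1 - lam) + C * ((1 - c) * (1 - sig * (1 - vh - mh)) + c * sig * vh)) - (((1 - c) * (1 - sig * (1 - vh - mh)) + c * sig * vh) * ((1 + lam) * C * c - 1) * (vh + mh) + lam * (1 - C) * c * sig * vh)) = (c * vh * (c * (1 - sig * vh)) * (3 / 4)) + (c * vh * (c * (1 - sig * vh) * (C * ((1 - c) * (1 - sig * (1 - vh - mh)) + c * sig * vh) - (lam * (1 - lam))) + 3 / 4 * ((1 - c) * (1 - sig * (1 - vh - mh)) + c * sig * vh))) + (c * vh * ((1 - c) * (1 - sig * (1 - vh - mh)) + c * sig * vh) * (C * ((1 - c) * (1 - sig * (1 - vh - mh)) + c * sig * vh) - (lam * (1 - lam))) - (((1 - c) * (1 - sig * (1 - vh - mh)) + c * sig * vh) * ((1 + lam) * C * c - 1) * (vh + mh) + lam * (1 - C) * c * sig * vh)) := by ring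
  rcases le_or_gt (c * vh * ((1 - c) * (1 - sig * (1 - vh - mh)) + c * sig * vh) * (C * ((1 - c) * (1 - sig * (1 - vh - mh)) + c * sig * vh) - (lam * (1 - lam))) - (((1 - c) * (1 - sig * (1 - vh - mh)) + c * sig * vh) * ((1 + lam) * C * c - 1) * (vh + mh) + lam * (1 - C) * c * sig * vh)) 0 with hA2 | hA2
  · -- concave case: slack(a) = (1−a)·slack(0) + a·slack(1) − α₂·a(1−a)
    have e2 : (c * vh * (c * (1 - sig * vh)) * (3 / 4)) + (c * vh * (c * (1 - sig * vh) * (C * ((1 - c) * (1 - sig * (1 - vh - mh)) + c * sig * vh) - (lam * (1 - lam))) + 3 / 4 * ((1 - c) * (1 - sig * (1 - vh - mh)) + c * sig * vh))) * a + (c * vh * ((1 - c) * (1 - sig * (1 - vh - mh)) + c * sig * vh) * (C * ((1 - c) * (1 - sig * (1 - vh - mh)) + c * sig * vh) - (lam * (1 - lam))) - (((1 - c) * (1 - sig * (1 - vh - mh)) + c * sig * vh) * ((1 + lam) * C * c - 1) * (vh + mh) + lam * (1 - C) * c * sig * vh)) * a ^ 2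
        = (1 - a) * (c * vh * (c * (1 - sig * vh)) * (3 / 4)) + a * ((c * vh * (c * (1 - sig * vh)) * (3 / 4)) + (c * vh * (c * (1 - sig * vh) * (C * ((1 - c) * (1 - sig * (1 - vh - mh)) + c * sig * vh) - (lam * (1 - lam))) + 3 / 4 * ((1 - c) * (1 - sig * (1 - vh - mh)) + c * sig * vh))) + (c * vh * ((1 - c) * (1 - sig * (1 - vh - mh)) + c * sig * vh) * (C * ((1 - c) * (1 - sig * (1 - vh - mh)) + c * sig * vh) - (lam * (1 - lam))) - (((1 - c) * (1 - sig * (1 - vh - mh)) + c * sig * vh) * ((1 + lam) * C * c - 1) * (vh + mh) + lam * (1 - C) * c * sig * vh))) - (c * vh * ((1 - c) * (1 - sig * (1 - vh - mh)) + c * sig * vh) * (C * ((1 - c) * (1 - sig * (1 - vh - mh)) + c * sig * vh) - (lam * (1 - lam))) - (((1 - c) * (1 - sig * (1 - vh - mh)) + c * sig * vh) * ((1 + lam) * C * c - 1) * (vh + mh) + lam * (1 - C) * c * sig * vh)) * (a * (1 - a)) := by ring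
    have t1 : 0 ≤ (1 - a) * (c * vh * (c * (1 - sig * vh)) * (3 / 4)) := mul_nonneg (sub_nonneg.mpr ha1) hA0
    have t2 : 0 ≤ a * ((c * vh * (c * (1 - sig * vh)) * (3 / 4)) + (c * vh * (c * (1 - sig * vh) * (C * ((1 - c) * (1 - sig * (1 - vh - mh)) + c * sig * vh) - (lam * (1 - lam))) + 3 / 4 * ((1 - c) * (1 - sig * (1 - vh - mh)) + c * sig * vh))) + (c * vh * ((1 - c) * (1 - sig * (1 - vh - mh)) + c * sig * vh) * (C * ((1 - c) * (1 - sig * (1 - vh - mh)) + c * sig * vh) - (lam * (1 - lam))) - (((1 - c) * (1 - sig * (1 - vh - mh)) + c * sig * vh) * ((1 + lam) * C * c - 1) * (vh + mh) + lam * (1 - C) * c * sig * vh))) := by rw [← keyF1]; exact mul_nonneg ha0 hF1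
    have t3 : 0 ≤ - (c * vh * ((1 - c) * (1 - sig * (1 - vh - mh)) + c * sig * vh) * (C * ((1 - c) * (1 - sig * (1 - vh - mh)) + c * sig * vh) - (lam * (1 - lam))) - (((1 - c) * (1 - sig * (1 - vh - mh)) + c * sig * vh) * ((1 + lam) * C * c - 1) * (vh + mh) + lam * (1 - C) * c * sig * vh)) * (a * (1 - a)) := by
      have hx : 0 ≤ a * (1 - a) := mul_nonneg ha0 (sub_nonneg.mpr ha1)
      exact mul_nonneg (by linarith) hx
    linarith [key, e2, t1, t2, t3]
  · -- convex case: then Cν̂ > λ(1−λ), so α₁ ≥ 0 and all coefficients are ≥ 0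
    have hpos : 0 < C * ((1 - c) * (1 - sig * (1 - vh - mh)) + c * sig * vh) - (lam * (1 - lam)) := by
      by_contra h
      push Not at h
      have : c * vh * ((1 - c) * (1 - sig * (1 - vh - mh)) + c * sig * vh) * (C * ((1 - c) * (1 - sig * (1 - vh - mh)) + c * sig * vh) - (lam * (1 - lam))) ≤ 0 :=
        mul_nonpos_of_nonneg_of_nonpos (mul_nonneg (mul_nonneg hc0.le hv0) hN0) h
      linarith
    have hA1 : 0 ≤ (c * vh * (c * (1 - sig * vh) * (C * ((1 - c) * (1 - sig * (1 - vh - mh)) + c * sig * vh) - (lam * (1 - lam))) + 3 / 4 * ((1 - c) * (1 - sig * (1 - vh - mh)) + c * sig * vh))) := by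
      have : 0 ≤ c * (1 - sig * vh) * (C * ((1 - c) * (1 - sig * (1 - vh - mh)) + c * sig * vh) - (lam * (1 - lam))) := mul_nonneg (mul_nonneg hc0.le hsv) hpos.le
      have h2 : 0 ≤ 3 / 4 * ((1 - c) * (1 - sig * (1 - vh - mh)) + c * sig * vh) := by linarith
      have h3 : 0 ≤ c * vh := mul_nonneg hc0.le hv0
      exact mul_nonneg h3 (by linarith)
    have t1 : 0 ≤ (c * vh * (c * (1 - sig * vh) * (C * ((1 - c) * (1 - sig * (1 - vh - mh)) + c * sig * vh) - (lam * (1 - lam))) + 3 / 4 * ((1 - c) * (1 - sig * (1 - vh - mh)) + c * sig * vh))) * a := mul_nonneg hA1 ha0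
    have t2 : 0 ≤ (c * vh * ((1 - c) * (1 - sig * (1 - vh - mh)) + c * sig * vh) * (C * ((1 - c) * (1 - sig * (1 - vh - mh)) + c * sig * vh) - (lam * (1 - lam))) - (((1 - c) * (1 - sig * (1 - vh - mh)) + c * sig * vh) * ((1 + lam) * C * c - 1) * (vh + mh) + lam * (1 - C) * c * sig * vh)) * a ^ 2 := mul_nonneg hA2.le (sq_nonneg a)
    linarith [key, t1, t2, hA0]

end PocketCert

end Summit.CriticalPhenomena.PercolationContinuityZ3.Theorems
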